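import Mathlib
import Summits.NavierStokesRegularity.NavierStokesRegularity.Theorems.EulerZoomLiouvillePowerGaugeEulerLiouvilleSelfSimilarSourceNode
import Literature.Analysis.ODE.LyapunovAdaptedInnerProduct
import Literature.Analysis.ODE.SpectralBoundExponentialGrowth
import HarnessLib.Audit

/-!
# Rung C1 of the crux `EulerZoomLiouville.PowerGaugeEulerLiouville`: vorticity vanishes near every
# stagnation point whose linearisation is EXPONENTIALLY DICHOTOMOUS with rates in `(0, 1 + γ)`
# (route №10, item stmt-NavierStokesRegularity-19832; `--supports`)

Helper file (theorems only). Seat ns-typeII-p1 g6 (cell ns-regularity-ideate §B, D-0081), serving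
ns-typeII-p3 g6's crux idea «hyperbolic-stagnation exclusion» (evidence #41 on 19832; KEEP-2 (L)):
p3's `curl_eq_zero_near_adaptedSourceNode` (`…SelfSimilarSourceNode`) assumes an ADAPTED inner
product `G` pinching the symmetric part of `DW(y*) = γI + DV(y*)` between `μ₀ > 0` and `Λ₀ < 1 + γ`.
The Literature lemma `Literature.Analysis.ODE.exists_adaptedCLM_of_expDichotomy` (Khalil Thm 4.6,
Lyapunov operators `G₁ + G₂`) manufactures such a `G` from the EXPONENTIAL DICHOTOMY of the
linearisation: `‖e^{tA}‖ ≤ C e^{bt}`, `‖e^{−tA}‖ ≤ C e^{−at}` (`t ≥ 0`) with `0 < a ≤ b < 1 + γ`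
(for a matrix: all eigenvalues with real part in `[a, b] ⊂ (0, 1+γ)`, e.g. every hyperbolic SOURCE
in the window, whose real parts are `< tr DW = 3γ < 1 + γ`).

* `curl_eq_zero_near_dichotomousSourceNode` — crux hypotheses on the classical profile as in p3's
  files (`V` smooth with bounded gradient, `IsSelfSimilarEulerProfile γ 0 V P`), a zero `y*` of
  `W = γy + V` whose linearisation `A = γ·id + DV(y*)` is exponentially dichotomous with rates in
  `(0, 1+γ)` ⇒ `curl V ≡ 0` on a Euclidean ball around `y*`.

WHAT THIS IS NOT: not NS, not E, not C1 — the passage «spectrum of `DW(y*)` in `{0 < Re λ < 1+γ}`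
⇒ exponential dichotomy» (Jordan form) and the global step (M) of the idea remain; classical profiles only.
-/

noncomputable section

-- flat `Theorems/<Route><Decl>…` files of one crux share the namespace of the crux (tree convention)
set_option linter.dupNamespace false

open MeasureTheory Set Filter Topology Metric Function InnerProductSpace NormedSpace
open scoped RealInnerProductSpace NNReal ContDiff

namespace Summit.NavierStokesRegularity.NavierStokesRegularity.Theorems.PowerGaugeEulerLiouville.Kelvin

open Literature.Analysis Literature.Analysis.FluidPDE

variable {γ : ℝ} {V : EuclideanSpace ℝ (Fin 3) → EuclideanSpace ℝ (Fin 3)} {P : EuclideanSpace ℝ (Fin 3) → ℝ}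

/-- **Vorticity vanishes near an exponentially dichotomous source node.**  If `y*` is a zero of
`W = γy + V` and the linearisation `A = γ·id + DV(y*)` satisfies `‖e^{tA}‖ ≤ C e^{bt}` and
`‖e^{−tA}‖ ≤ C e^{−at}` for `t ≥ 0` with `0 < a ≤ b < 1 + γ`, then `curl V ≡ 0` on a ball around `y*`
(adapted inner product from `Literature.Analysis.ODE.exists_adaptedCLM_of_expDichotomy` with
`a' = a/2`, `b' = (b + 1 + γ)/2`, then p3's `curl_eq_zero_near_adaptedSourceNode`).
[cite: ConstantinIgnatovaVicol2026Putative, §3.5 Prop. 3.9 (the outgoing node it upgrades); Khalil2002, Thm 4.6] -/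
theorem curl_eq_zero_near_dichotomousSourceNode (hV : ContDiff ℝ ∞ V) {K : ℝ}
    (hK : ∀ y, ‖fderiv ℝ V y‖ ≤ K) (hprof : IsSelfSimilarEulerProfile γ 0 V P)
    {ystar : EuclideanSpace ℝ (Fin 3)} (hstar : selfSimilarTransport γ 0 V ystar = 0)
    {a b C : ℝ} (ha : 0 < a) (hab : a ≤ b) (hb : b < 1 + γ)
    (hup : ∀ t : ℝ, 0 ≤ t →
      ‖exp (t • (γ • ContinuousLinearMap.id ℝ (EuclideanSpace ℝ (Fin 3)) + fderiv ℝ V ystar))‖ ≤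
        C * Real.exp (b * t))
    (hlow : ∀ t : ℝ, 0 ≤ t →
      ‖exp (-(t • (γ • ContinuousLinearMap.id ℝ (EuclideanSpace ℝ (Fin 3)) + fderiv ℝ V ystar)))‖ ≤
        C * Real.exp (-a * t)) :
    ∃ r : ℝ, 0 < r ∧ ∀ y : EuclideanSpace ℝ (Fin 3), ‖y - ystar‖ < r → curl V y = 0 := by
  set A : EuclideanSpace ℝ (Fin 3) →L[ℝ] EuclideanSpace ℝ (Fin 3) :=
    γ • ContinuousLinearMap.id ℝ (EuclideanSpace ℝ (Fin 3)) + fderiv ℝ V ystar with hA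
  have hA' : ∀ h : EuclideanSpace ℝ (Fin 3), A h = γ • h + fderiv ℝ V ystar h := fun h => rfl
  -- the adapted inner product, pinching between `a/2 > 0` and `(b + 1 + γ)/2 < 1 + γ`
  obtain ⟨G, hGsym, ⟨g₀, hg₀, hGpos⟩, hpinch⟩ :=
    Literature.Analysis.ODE.exists_adaptedCLM_of_expDichotomy A (a' := a / 2) (b' := (b + (1 + γ)) / 2)
      (by linarith) (by linarith) (by linarith) hup hlow
  have hnode : ∀ h : EuclideanSpace ℝ (Fin 3),
      a / 2 * ⟪G h, h⟫ ≤ ⟪G (γ • h + fderiv ℝ V ystar h), h⟫ ∧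
        ⟪G (γ • h + fderiv ℝ V ystar h), h⟫ ≤ (b + (1 + γ)) / 2 * ⟪G h, h⟫ := fun h => by
    rw [← hA']; exact hpinch h
  obtain ⟨r, hr, hzero⟩ := curl_eq_zero_near_adaptedSourceNode hV hK hprof hstar hGsym hg₀ hGpos
    (by linarith : 0 < a / 2) (by linarith : (b + (1 + γ)) / 2 < 1 + γ) hnode
  -- a Euclidean ball inside the `G`-ball
  refine ⟨r / Real.sqrt (‖G‖ + 1), by positivity, fun y hy => hzero y ?_⟩
  have hs : 0 < Real.sqrt (‖G‖ + 1) := Real.sqrt_pos.2 (by positivity)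
  have hy' : ‖y - ystar‖ * Real.sqrt (‖G‖ + 1) < r := (lt_div_iff₀ hs).1 hy
  have hsq : (Real.sqrt (‖G‖ + 1)) ^ 2 = ‖G‖ + 1 := Real.sq_sqrt (by positivity)
  calc ⟪G (y - ystar), y - ystar⟫ ≤ ‖G (y - ystar)‖ * ‖y - ystar‖ := real_inner_le_norm _ _
    _ ≤ ‖G‖ * ‖y - ystar‖ * ‖y - ystar‖ := by gcongr; exact G.le_opNorm _
    _ ≤ (‖G‖ + 1) * ‖y - ystar‖ ^ 2 := by nlinarith [norm_nonneg G, sq_nonneg ‖y - ystar‖]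
    _ = (‖y - ystar‖ * Real.sqrt (‖G‖ + 1)) ^ 2 := by rw [mul_pow, hsq]; ring
    _ < r ^ 2 := pow_lt_pow_left₀ hy' (by positivity) two_ne_zero

/-- **Vorticity vanishes near a SPECTRAL source node.**  If `y*` is a zero of `W = γy + V` and the
linearisation `A = γ·id + DV(y*)`, read through ANY complexification `ι : ℝ³ → F` (`ι` a real-linear
isometry into a finite-dimensional complex space, `T` complex-linear with `ι ∘ A = T ∘ ι`), has all its
eigenvalues in the strip `a < Re μ < b` with `0 < a ≤ b < 1 + γ`, then `curl V ≡ 0` on a ball around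
`y*`: `Literature.Analysis.ODE.exists_norm_exp_smul_le_of_eigenvalues_re_lt` /
`exists_norm_exp_neg_smul_le_of_lt_eigenvalues_re` (generalized eigenspaces) give the exponential
dichotomy of `T`, `norm_exp_smul_le_of_semiconj` transfers it to `A`, and
`curl_eq_zero_near_dichotomousSourceNode` concludes.  In the window `γ < 1/2` every HYPERBOLIC SOURCE
(`Re μ > 0` for all three eigenvalues; their sum is `tr A = 3γ`, so each `Re μ < 3γ < 1 + γ`) is such
a node. [cite: ConstantinIgnatovaVicol2026Putative, §3.5 Prop. 3.9; Khalil2002, §4.3 (4.11) and Thm 4.6] -/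
theorem curl_eq_zero_near_spectralSourceNode (hV : ContDiff ℝ ∞ V) {K : ℝ}
    (hK : ∀ y, ‖fderiv ℝ V y‖ ≤ K) (hprof : IsSelfSimilarEulerProfile γ 0 V P)
    {ystar : EuclideanSpace ℝ (Fin 3)} (hstar : selfSimilarTransport γ 0 V ystar = 0)
    {F : Type*} [NormedAddCommGroup F] [NormedSpace ℂ F] [CompleteSpace F] [FiniteDimensional ℂ F]
    (ι : EuclideanSpace ℝ (Fin 3) →ₗᵢ[ℝ] F) (T : F →L[ℂ] F)
    (hι : ∀ v : EuclideanSpace ℝ (Fin 3),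
      ι ((γ • ContinuousLinearMap.id ℝ (EuclideanSpace ℝ (Fin 3)) + fderiv ℝ V ystar) v) = T (ι v))
    {a b : ℝ} (ha : 0 < a) (hab : a ≤ b) (hb : b < 1 + γ)
    (hspec : ∀ μ : ℂ, Module.End.HasEigenvalue (T : F →ₗ[ℂ] F) μ → a < μ.re ∧ μ.re < b) :
    ∃ r : ℝ, 0 < r ∧ ∀ y : EuclideanSpace ℝ (Fin 3), ‖y - ystar‖ < r → curl V y = 0 := by
  set A : EuclideanSpace ℝ (Fin 3) →L[ℝ] EuclideanSpace ℝ (Fin 3) :=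
    γ • ContinuousLinearMap.id ℝ (EuclideanSpace ℝ (Fin 3)) + fderiv ℝ V ystar with hA
  obtain ⟨C₁, hC₁⟩ := Literature.Analysis.ODE.exists_norm_exp_smul_le_of_eigenvalues_re_lt T
    (β := b) fun μ hμ => (hspec μ hμ).2
  obtain ⟨C₂, hC₂⟩ := Literature.Analysis.ODE.exists_norm_exp_neg_smul_le_of_lt_eigenvalues_re T
    (α := a) fun μ hμ => (hspec μ hμ).1
  have hup : ∀ t : ℝ, 0 ≤ t → ‖exp (t • A)‖ ≤ max C₁ C₂ * Real.exp (b * t) := by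
    intro t ht
    have h1 := (Literature.Analysis.ODE.norm_exp_smul_le_of_semiconj ι A T hι t).2
    exact h1.trans ((hC₁ t ht).trans (mul_le_mul_of_nonneg_right (le_max_left _ _) (Real.exp_nonneg _)))
  have hlow : ∀ t : ℝ, 0 ≤ t → ‖exp (-(t • A))‖ ≤ max C₁ C₂ * Real.exp (-a * t) := by
    intro t ht
    have h1 := (Literature.Analysis.ODE.norm_exp_smul_le_of_semiconj ι A T hι (-t)).2
    have e1 : (-t) • A = -(t • A) := neg_smul t A
    have e2 : ((-t : ℝ) : ℂ) • T = -((t : ℂ) • T) := by rw [Complex.ofReal_neg, neg_smul]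
    rw [e1, e2] at h1
    exact h1.trans ((hC₂ t ht).trans (mul_le_mul_of_nonneg_right (le_max_right _ _) (Real.exp_nonneg _)))
  exact curl_eq_zero_near_dichotomousSourceNode hV hK hprof hstar ha hab hb hup hlow

end Summit.NavierStokesRegularity.NavierStokesRegularity.Theorems.PowerGaugeEulerLiouville.Kelvin

end
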